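import Mathlib
import Summits.ValiantsHypothesis.ValiantsHypothesis.Theses.FeketeSOS

/-!
# Sketch — crux idea `euler-disc` for `FeketeSOS.FeketeSOSHard` (stmt-ValiantsHypothesis-3996)

First-lemma signatures only (no proofs are claimed here; everything must ELABORATE).

The lever: count zeros of a representation `R = ∑ cᵢ gᵢ²` in the *p-adic Euler disc*
`D* = {x : v_p(x - 1) ≥ c/(p-1)}`, `1 < c ≤ 2` — radius `r_p^c`, `r_p = p^{-1/(p-1)} = |ζ_p - 1|_p`,
strictly INSIDE the disc that carries `μ_p`.  By the theory of Newton polygons the count equals the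
*Euler index*: the largest `k` maximising `‖ρ_k‖ · p^{-ck/(p-1)}`, `ρ_k` = `k`-th Taylor coefficient
of `R` at `1` (Lenstra 1999, §3).  We therefore DEFINE the invariant through Taylor coefficients and a
nonarchimedean norm, so that no `ℂ_p`-analysis is needed to state anything.
-/

namespace Summit.ValiantsHypothesis.ValiantsHypothesis.Cruxes.FeketeSOSHard.EulerDisc

open Polynomial Finset
open scoped BigOperators Classical

noncomputable section

/-- The Fekete polynomial with coefficients in a ring `R`: `∑_{m<p} (m|p) X^m`. -/
def fekete (R : Type*) [Ring R] (p : ℕ) [Fact p.Prime] : R[X] :=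
  ∑ m ∈ range p, C ((legendreSym p m : ℤ) : R) * X ^ m

/-- Euler weight of the `k`-th Taylor coefficient at `1`: `‖ρ_k‖ · p^{-c k/(p-1)}`. -/
def eulerWeight (p : ℕ) (c : ℝ) {K : Type*} [NormedField K] (R : K[X]) (k : ℕ) : ℝ :=
  ‖(taylor 1 R).coeff k‖ * (p : ℝ) ^ (-(c * k / ((p : ℝ) - 1)))

/-- Euler index `Z_c(R)`: the largest Taylor index at `1` whose Euler weight is maximal (0 for `R = 0`).
Over an algebraically closed complete field this is the number of zeros `x` of `R` with
`v_p(x-1) ≥ c/(p-1)` counted with multiplicity (Newton polygon of `R(1+Y)`). -/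
def eulerIndex (p : ℕ) (c : ℝ) {K : Type*} [NormedField K] (R : K[X]) : ℕ :=
  ((taylor 1 R).support.filter
    (fun k => ∀ l ∈ (taylor 1 R).support, eulerWeight p c R l ≤ eulerWeight p c R k)).sup id

/-- A `p`-adically normalised ultrametric field of characteristic zero. -/
def IsPadicNormed (p : ℕ) (K : Type*) [NormedField K] : Prop :=
  IsUltrametricDist K ∧ CharZero K ∧ ‖(p : K)‖ = (p : ℝ)⁻¹

/-! ## (E) Euler: the Fekete polynomial has Euler index exactly `(p-1)/2` — provable now -/

/-- Divisibility form (in tree already as `stub_feketeModPOrder` / MNT 2023 Prop. 5.1, here in Taylor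
coordinates): `p ∣ ρ_k(F_p)` for `k < (p-1)/2` and `p ∤ ρ_{(p-1)/2}(F_p)`. [provable now, S] -/
def FeketeTaylorDivisibility : Prop :=
  ∀ (p : ℕ) [Fact p.Prime], p ≠ 2 →
    (∀ k, k < (p - 1) / 2 → (p : ℤ) ∣ (taylor 1 (fekete ℤ p)).coeff k) ∧
    ¬ (p : ℤ) ∣ (taylor 1 (fekete ℤ p)).coeff ((p - 1) / 2)

/-- (E) For every odd prime `p`, every `c ∈ (1, 2]` and every `p`-adically normalised ultrametric field
`K`, the Euler index of `F_p` is `(p-1)/2`.  [provable now from `FeketeTaylorDivisibility`: weights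
`≥ 1` for `k < N`, `= p^{-c/2} > p^{-1}` at `k = N`, `< p^{-c/2}` for `k > N`; M] -/
def FeketeEulerIndex : Prop :=
  ∀ (p : ℕ) [Fact p.Prime], p ≠ 2 → ∀ c : ℝ, 1 < c → c ≤ 2 →
    ∀ (K : Type) [NormedField K], IsPadicNormed p K →
      eulerIndex p c (fekete K p) = (p - 1) / 2

/-! ## (L) Lenstra's ultrametric Descartes rule in the Euler disc — a theorem in print -/

/-- Lenstra 1999, Theorem 3 with the Remark of §3 (`d_k(n)` replaced by `n!`, valid for
`r > 1/(p-1)`), in index form: a polynomial with at most `t` terms has Euler index `≤ t - 1` at every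
`c > 1` with `(t-1)·c < p·(c-1) + 1`.  [in print; to be vendored as a Literature fact] -/
def LenstraCloseZeros : Prop :=
  ∀ (p : ℕ) [Fact p.Prime] (c : ℝ), 1 < c →
    ∀ (K : Type) [NormedField K], IsPadicNormed p K →
      ∀ (g : K[X]) (t : ℕ), g ≠ 0 → g.support.card ≤ t →
        ((t : ℝ) - 1) * c < (p : ℝ) * (c - 1) + 1 →
        eulerIndex p c g ≤ t - 1

/-- Multiplicativity of the Euler index (Gauss norm on the closed disc is multiplicative; the terminal
dominant index adds).  [provable now, M] -/
def EulerIndexMul : Prop :=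
  ∀ (p : ℕ) [Fact p.Prime] (c : ℝ), 0 < c →
    ∀ (K : Type) [NormedField K], IsUltrametricDist K →
      ∀ (A B : K[X]), A ≠ 0 → B ≠ 0 →
        eulerIndex p c (A * B) = eulerIndex p c A + eulerIndex p c B

/-! ## (P) The load-bearing conjecture: p-adic order–sparsity for SUMS in the Euler disc -/

/-- `pOS_p` in the crux's own asymptotic shape (`c = 2`, the square of the cyclotomic radius): a sum of
`s ≤ p^δ` weighted squares of polynomials of total support `< p^{1/2+δ}` over a `p`-adically normalised
ultrametric field never has Euler index EXACTLY `(p-1)/2`.  [NEW, open; r = 1 (one product = two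
squares) follows from `LenstraCloseZeros` + `EulerIndexMul` with the linear bound `(p+3)/2`] -/
def PadicOrderSparsity : Prop :=
  ∃ δ : ℝ, 0 < δ ∧ ∃ p₀ : ℕ, ∀ (p : ℕ) [Fact p.Prime], p₀ ≤ p →
    ∀ (K : Type) [NormedField K], IsPadicNormed p K →
      ∀ (s : ℕ) (c : Fin s → K) (g : Fin s → K[X]),
        (s : ℝ) ≤ (p : ℝ) ^ δ → (∑ i, ((g i).support.card : ℝ)) < (p : ℝ) ^ (1 / 2 + δ) →
        eulerIndex p 2 (∑ i, C (c i) * g i ^ 2) ≠ (p - 1) / 2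

/-- The natural TARGET-FREE linear form below the Frobenius threshold: for support-sum `≤ ε₀·p` the
Euler index is at most `C·(s + support-sum)`.  (The unrestricted linear form is FALSE: the
"Frobenius + lift" family `x^e (x^p - 1) + p·W` reaches index `p` at support `≈ (1 - 1/c)·p`.) [NEW, open] -/
def PadicOrderSparsityLinear : Prop :=
  ∃ C₀ ε₀ : ℝ, 0 < ε₀ ∧ ∀ (p : ℕ) [Fact p.Prime],
    ∀ (K : Type) [NormedField K], IsPadicNormed p K →
      ∀ (s : ℕ) (c : Fin s → K) (g : Fin s → K[X]),
        (∑ i, ((g i).support.card : ℝ)) ≤ ε₀ * p →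
        (eulerIndex p 2 (∑ i, C (c i) * g i ^ 2) : ℝ) ≤ C₀ * (s + ∑ i, ((g i).support.card : ℝ))

/-! ## (T) Transfer vehicle: complex representations embed into a p-adically normed field -/

/-- For every prime `p` there is a `p`-adically normalised ultrametric field receiving a ring
homomorphism from `ℂ`.  [provable now: `K := PadicAlgCl p = AlgebraicClosure ℚ_[p]` with its spectral
norm, and the abstract field isomorphism `AlgebraicClosure ℚ_[p] ≃+* ℂ` of the tree lemma
`Literature.NumberTheory.GaloisRepresentations.NumberField.nonempty_algebraicClosure_padic_ringEquiv_complex`] -/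
def PadicEmbedding : Prop :=
  ∀ (p : ℕ) [Fact p.Prime], ∃ (K : Type) (_ : NormedField K), IsPadicNormed p K ∧ Nonempty (ℂ →+* K)

/-! ## Composition (pure logic + `Polynomial.map`): how the crux follows -/

/-- `pOS_p ∧ (E) ∧ (T) → FeketeSOSHard`: push a cheap complex representation through `φ : ℂ →+* K`
(supports do not grow, `F_p` has integer coefficients so `φ(F_p) = F_p`), read the Euler index of both
sides: `(p-1)/2` by (E), `≠ (p-1)/2` by `pOS_p`.  No reduction, no good/bad-reduction split, no
de-bordering: the Euler index is insensitive to scaling. -/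
def Composition : Prop :=
  PadicOrderSparsity → FeketeEulerIndex → PadicEmbedding →
    Summit.ValiantsHypothesis.ValiantsHypothesis.Theses.FeketeSOS.FeketeSOSHard

/-- The composition holds (pure logic + `Polynomial.map`). -/
theorem composition : Composition := by
  intro hP hE hT
  obtain ⟨δ, hδ, p₀, hstar⟩ := hP
  refine ⟨δ, hδ, max p₀ 3, ?_⟩
  intro p hp hp₀ s c g hs hdeg hrep
  have hp₀' : p₀ ≤ p := le_trans (le_max_left _ _) hp₀
  have hp3 : 3 ≤ p := le_trans (le_max_right _ _) hp₀
  have hp2 : p ≠ 2 := by omega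
  by_contra hlt
  push Not at hlt
  obtain ⟨K, instK, hK, ⟨φ⟩⟩ := hT p
  -- transport the representation
  have hinj : Function.Injective φ := φ.injective
  have hmap : (∑ i, C (φ (c i)) * (g i).map φ ^ 2) = fekete K p := by
    have := congrArg (Polynomial.map φ) hrep
    simp only [Polynomial.map_sum, Polynomial.map_mul, Polynomial.map_pow, Polynomial.map_C,
      map_intCast, Polynomial.map_X] at this
    simpa [fekete] using this
  have hsupp : ∀ i, ((g i).map φ).support.card = (g i).support.card := fun i => by
    rw [Polynomial.support_map_of_injective _ hinj]
  have hidxF : eulerIndex p 2 (fekete K p) = (p - 1) / 2 := hE p hp2 2 (by norm_num) le_rfl K hK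
  have hne := hstar p hp₀' K hK s (fun i => φ (c i)) (fun i => (g i).map φ) hs (by
    simpa [hsupp] using hlt)
  exact hne (hmap ▸ hidxF)

/-! ## Calibration statements (what the invariant does to the known witnesses) — provable now -/

/-- The socle tiling `[a]_x [b]_{x^a} + x^{ab}[c]_x = ∑_{m<p} x^m` (`p = ab + c`), which killed every
order–sparsity inequality in characteristic `p` (ord = p-1 from two products of support ≈ 3√p), has
Euler index `0` at every `c > 1`: its only Taylor coefficient of valuation `0` is the last one and
`ρ_0 = p`.  [provable now, S] -/
def SocleTilingEulerIndex : Prop :=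
  ∀ (p : ℕ) [Fact p.Prime], p ≠ 2 → ∀ c : ℝ, 1 < c →
    ∀ (K : Type) [NormedField K], IsPadicNormed p K →
      eulerIndex p c (∑ m ∈ range p, (X : K[X]) ^ m) = 0

/-- Frobenius is harmless in the Euler disc: `x^p - 1` (char-`p` order `p` at `x = 1`) has Euler index
`1` for every `c > 1`.  [provable now, S] -/
def FrobeniusEulerIndex : Prop :=
  ∀ (p : ℕ) [Fact p.Prime], p ≠ 2 → ∀ c : ℝ, 1 < c →
    ∀ (K : Type) [NormedField K], IsPadicNormed p K →
      eulerIndex p c ((X : K[X]) ^ p - 1) = 1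

end

end Summit.ValiantsHypothesis.ValiantsHypothesis.Cruxes.FeketeSOSHard.EulerDisc
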